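import Summits.Ventures.PercRepro.MSTwin

/-!
# Twin classes under projection along a twin

In the induction of Theorem S (proofs/MINE1-theoremS.md) a family with twins is handled by
*contracting* a twin class. Here contraction is realised inside the ambient type by the kernel's
projection `proj b F = {t.erase b : t ∈ F}` (`MSTightProj.lean`) along an element `b` that has a
twin `a ≠ b`: the projection is tight when `F` is (`tight_proj_and_partner`), its twin relation
away from `b` is that of `F` (`twin_proj_iff`), the class of `a` loses exactly `b`
(`cls_proj_eq`), and closure of the projection under adding / removing the class of `a` lifts back
to `F` (`closedAdd_of_proj`, `closedRem_of_proj`): a member `s` of `F` with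
`s.erase b = t.erase b ∪ (cls F a).erase b` contains `a`, hence its twin `b`, so `s = t ∪ cls F a`.
-/

namespace PercRepro.MSTight

open Finset
open scoped FinsetFamily

variable {α : Type*} [DecidableEq α]

/-- Away from `b`, twinness in the projection along `b` is twinness in `F`. -/
theorem twin_proj_iff {F : Finset (Finset α)} {b a x : α} (hab : a ≠ b) (hxb : x ≠ b) :
    Twin (proj b F) a x ↔ Twin F a x := by
  constructor
  · intro h t ht
    have := h (t.erase b) (mem_proj.2 ⟨t, ht, rfl⟩)
    simpa [Finset.mem_erase, hab, hxb] using this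
  · intro h t' ht'
    obtain ⟨t, ht, rfl⟩ := mem_proj.1 ht'
    simp [Finset.mem_erase, hab, hxb, h t ht]

/-- An element `a ≠ b` of some member is not a twin of `b` in the projection along `b`. -/
theorem not_twin_proj {F : Finset (Finset α)} {a b : α} (hab : a ≠ b) {t : Finset α} (ht : t ∈ F)
    (hat : a ∈ t) : ¬ Twin (proj b F) a b := by
  intro h
  have := (h (t.erase b) (mem_proj.2 ⟨t, ht, rfl⟩)).1 (Finset.mem_erase.2 ⟨hab, hat⟩)
  exact Finset.notMem_erase b t this

/-- The projection of a family supported on `u` along `b` is supported on `u.erase b`. -/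
theorem proj_subset_erase {F : Finset (Finset α)} {u : Finset α} (hFu : ∀ A ∈ F, A ⊆ u) (b : α) :
    ∀ A ∈ proj b F, A ⊆ u.erase b := by
  intro A hA
  obtain ⟨B, hB, rfl⟩ := mem_proj.1 hA
  exact Finset.erase_subset_erase b (hFu B hB)

variable [Fintype α]

/-- The class of `a` in the projection along `b ≠ a` is its class in `F` without `b`. -/
theorem cls_proj_eq {F : Finset (Finset α)} {a b : α} (hab : a ≠ b) {t : Finset α} (ht : t ∈ F)
    (hat : a ∈ t) : cls (proj b F) a = (cls F a).erase b := by
  ext x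
  rw [mem_cls, Finset.mem_erase, mem_cls]
  by_cases hxb : x = b
  · subst hxb
    simp [not_twin_proj hab ht hat]
  · rw [twin_proj_iff hab hxb]
    simp [hxb]

/-- Closure under adding the class of `a` lifts from the projection along a twin `b` of `a`. -/
theorem closedAdd_of_proj {F : Finset (Finset α)} {a b : α} (hab : a ≠ b) (htw : Twin F a b)
    {t₁ : Finset α} (ht₁ : t₁ ∈ F) (hat : a ∈ t₁)
    (h : ClosedAdd (proj b F) (cls (proj b F) a)) : ClosedAdd F (cls F a) := by
  intro t ht
  rw [cls_proj_eq hab ht₁ hat] at h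
  obtain ⟨s, hs, hse⟩ := mem_proj.1 (h (t.erase b) (mem_proj.2 ⟨t, ht, rfl⟩))
  have has : a ∈ s := by
    have : a ∈ s.erase b := by
      rw [hse]
      exact mem_union.2 (Or.inr (mem_erase.2 ⟨hab, self_mem_cls F a⟩))
    exact (mem_erase.1 this).2
  have hbs : b ∈ s := (htw s hs).1 has
  have hba : b ∈ cls F a := mem_cls.2 htw
  have : s = t ∪ cls F a := by
    ext x
    by_cases hxb : x = b
    · subst hxb
      simp [hbs, hba]
    · have hx : x ∈ s.erase b ↔ x ∈ t.erase b ∪ (cls F a).erase b := by rw [hse]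
      simp only [mem_erase, mem_union, hxb, ne_eq, not_false_eq_true, true_and] at hx
      rw [mem_union]
      exact hx
  rw [← this]
  exact hs

/-- Closure under removing the class of `a` lifts from the projection along a twin `b` of `a`. -/
theorem closedRem_of_proj {F : Finset (Finset α)} {a b : α} (hab : a ≠ b) (htw : Twin F a b)
    {t₁ : Finset α} (ht₁ : t₁ ∈ F) (hat : a ∈ t₁)
    (h : ClosedRem (proj b F) (cls (proj b F) a)) : ClosedRem F (cls F a) := by
  intro t ht
  rw [cls_proj_eq hab ht₁ hat] at h
  obtain ⟨s, hs, hse⟩ := mem_proj.1 (h (t.erase b) (mem_proj.2 ⟨t, ht, rfl⟩))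
  have has : a ∉ s := by
    intro has
    have : a ∈ s.erase b := mem_erase.2 ⟨hab, has⟩
    rw [hse] at this
    exact (mem_sdiff.1 this).2 (mem_erase.2 ⟨hab, self_mem_cls F a⟩)
  have hbs : b ∉ s := fun hbs => has ((htw s hs).2 hbs)
  have hba : b ∈ cls F a := mem_cls.2 htw
  have : s = t \ cls F a := by
    ext x
    by_cases hxb : x = b
    · subst hxb
      simp [hbs, hba]
    · have hx : x ∈ s.erase b ↔ x ∈ t.erase b \ (cls F a).erase b := by rw [hse]
      simp only [mem_erase, mem_sdiff, hxb, ne_eq, not_false_eq_true, true_and] at hx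
      rw [mem_sdiff]
      exact hx
  rw [← this]
  exact hs

/-- The class dichotomy at `a` lifts from the projection along a twin `b ≠ a` of `a`. -/
theorem closedAdd_or_closedRem_of_proj {F : Finset (Finset α)} {a b : α} (hab : a ≠ b)
    (htw : Twin F a b) {t₁ : Finset α} (ht₁ : t₁ ∈ F) (hat : a ∈ t₁)
    (h : ClosedAdd (proj b F) (cls (proj b F) a) ∨ ClosedRem (proj b F) (cls (proj b F) a)) :
    ClosedAdd F (cls F a) ∨ ClosedRem F (cls F a) :=
  h.imp (closedAdd_of_proj hab htw ht₁ hat) (closedRem_of_proj hab htw ht₁ hat)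

end PercRepro.MSTight
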